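import Mathlib
import Summits.KontsevichZagierPeriods.Zeta5Search.ThirdOrderDigit
import Summits.KontsevichZagierPeriods.Zeta5Search.ConstantTermFloorWindow
import Summits.KontsevichZagierPeriods.Zeta5Search.SecondDigitWProof
import HarnessLib

/-!
# ζ(5) search — SELF-CONJUGATE CLASSES HAVE ODD EXPONENT (`SelfConjugateOdd`, gen-2 g10, REPORT-gen2-g10 §6.1 (ii))

Cell `pub-zeta5` (HONEST FRAMING: systematic search; no irrationality claim unless certified), typer seat generation 12.
Discharges BY NAME `SecondOrder.SelfConjugateOdd` of `Zeta5Search/ThirdOrderDigit.lean`: if the centre `b₀/2` lies in the residue class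
of `x` (`p ∣ 2x − b₀`), then `classExp b p x` is odd.  Proof: the class is invariant under the reflection `s ↦ b₀ − s`, which preserves
`netExp`; the points off the centre pair up (`2s < b₀` with `2s > b₀`), so they contribute an even number; for `b₀` even the centre point
`b₀/2` lies in all seven blocks and has `netExp = 2 − 7 = −5`; for `b₀` odd the half-integer centre adds `+1`.  Consequently classes of even
exponent (`m`, `m+2` in THEOREM A⁗) are never self-conjugate.  Nothing here bears on irrationality.
-/

noncomputable section

open Finset

namespace Summit.KontsevichZagierPeriods.Zeta5Search.SecondOrder

open Summit.KontsevichZagierPeriods.Zeta5Search.DualSeries (InBox)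
open Summit.KontsevichZagierPeriods.Zeta5Search.CasoratianValuation (InPolytope)
open Summit.KontsevichZagierPeriods.Zeta5Search.ClusterValuation
open Summit.KontsevichZagierPeriods.Zeta5Search.BigPrime (block)

/-- The centre point of an even `b₀` lies in all seven blocks: `netExp (b₀/2) = −5`. -/
theorem netExp_centre (b : ℕ → ℤ) (hb : InPolytope b) {c : ℕ} (hc : 2 * (c : ℤ) = b 0) : netExp b c = -5 := by
  have h0 : 0 ≤ b 0 := hb.1.1
  have hcount : blockCount b c = 7 := by
    unfold blockCount
    have : (range 7).filter (fun j => c ∈ block (b 0).toNat (b (j + 1)).toNat) = range 7 := by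
      refine filter_true_of_mem fun j hj => ?_
      have h1 := hb.2.1 j hj
      have h2 := (hb.1.2 j hj).1
      simp only [block, mem_Icc]
      omega
    rw [this, card_range]
  unfold netExp
  rw [hcount, if_pos hc]
  norm_num

/-- **`SelfConjugateOdd` holds**: a class containing the centre has odd exponent. -/
theorem selfConjugateOdd_holds : SelfConjugateOdd := by
  intro b p x hb hprime hp5 hx hpole hcen
  haveI : Fact p.Prime := ⟨hprime⟩
  have h0 : 0 ≤ b 0 := hb.1.1
  set N := (b 0).toNat with hN
  have hb0 : (b 0 : ℤ) = N := (Int.toNat_of_nonneg h0).symm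
  have hxmem : x ∈ classSet b p x := base_mem_classSet b hx hpole
  have hxN : x ≤ N := le_of_mem_classSet b hxmem
  -- the class is self-conjugate
  have hconj : conjClass b p x = x := by
    have hdvd : (p : ℤ) ∣ (((N - x : ℕ) : ℤ)) - x := by
      have h1 : (((N - x : ℕ) : ℤ)) - x = -(2 * (x : ℤ) - b 0) := by rw [hb0]; push_cast [Nat.cast_sub hxN]; ring
      rw [h1, dvd_neg]; exact hcen
    have hmod : x % p = (N - x) % p := Nat.modEq_iff_dvd.2 hdvd
    show (N - x) % p = x
    rw [← hmod, Nat.mod_eq_of_lt hx]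
  have hsymm : ∀ s ∈ classSet b p x, N - s ∈ classSet b p x := fun s hs =>
    (mem_classSet_conj_iff b hxN (le_of_mem_classSet b hs)).1 (by rw [hconj]; exact hs)
  -- split the class sum into the lower half, the centre, the upper half
  set C := classSet b p x with hC
  have hsplit : ∑ s ∈ C, netExp b s =
      (∑ s ∈ C.filter (fun s => 2 * s < N), netExp b s) + (∑ s ∈ C.filter (fun s => 2 * s = N), netExp b s)
        + ∑ s ∈ C.filter (fun s => N < 2 * s), netExp b s := by
    rw [← sum_filter_add_sum_filter_not C (fun s => 2 * s < N), add_assoc]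
    congr 1
    rw [← sum_filter_add_sum_filter_not (C.filter fun s => ¬ 2 * s < N) (fun s => 2 * s = N), filter_filter, filter_filter]
    congr 1
    · exact sum_congr (filter_congr fun s _ => by omega) fun _ _ => rfl
    · exact sum_congr (filter_congr fun s _ => by omega) fun _ _ => rfl
  -- the two halves agree under the reflection
  have hrefl : ∑ s ∈ C.filter (fun s => N < 2 * s), netExp b s = ∑ s ∈ C.filter (fun s => 2 * s < N), netExp b s := by
    refine sum_nbij' (fun s => N - s) (fun s => N - s) (fun s hs => ?_) (fun s hs => ?_) (fun s hs => ?_) (fun s hs => ?_)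
      (fun s hs => ?_)
    · obtain ⟨hsC, hlt⟩ := mem_filter.1 hs
      have hsN := le_of_mem_classSet b hsC
      exact mem_filter.2 ⟨hsymm s hsC, by omega⟩
    · obtain ⟨hsC, hlt⟩ := mem_filter.1 hs
      have hsN := le_of_mem_classSet b hsC
      exact mem_filter.2 ⟨hsymm s hsC, by omega⟩
    · have hsN := le_of_mem_classSet b (mem_filter.1 hs).1; omega
    · have hsN := le_of_mem_classSet b (mem_filter.1 hs).1; omega
    · exact (netExp_reflect b h0 (le_of_mem_classSet b (mem_filter.1 hs).1)).symm
  -- the centre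
  have hcentre : (∑ s ∈ C.filter (fun s => 2 * s = N), netExp b s) = if 2 ∣ N then -5 else 0 := by
    by_cases hev : 2 ∣ N
    · obtain ⟨c, hc⟩ := hev
      have hcN : 2 * (c : ℤ) = b 0 := by rw [hb0, hc]; push_cast; ring
      -- the centre point `c` lies in the class
      have hcmem : c ∈ C := by
        refine mem_filter.2 ⟨mem_range.2 (by omega), ?_⟩
        have hp2 : ¬ (p : ℤ) ∣ 2 := by
          intro h
          have h2 := Int.le_of_dvd two_pos h
          have h5 : (5 : ℤ) ≤ p := by exact_mod_cast hp5
          omega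
        have hdvd : (p : ℤ) ∣ 2 * ((x : ℤ) - c) := by
          have e : 2 * ((x : ℤ) - c) = 2 * (x : ℤ) - b 0 := by rw [← hcN]; ring
          rw [e]; exact hcen
        have hdvd' : (p : ℤ) ∣ (x : ℤ) - c :=
          ((Nat.prime_iff_prime_int.1 hprime).dvd_or_dvd hdvd).resolve_left hp2
        exact Nat.modEq_iff_dvd.2 hdvd'
      have hfilter : C.filter (fun s => 2 * s = N) = {c} := by
        ext s
        simp only [mem_filter, mem_singleton]
        constructor
        · rintro ⟨-, hs⟩; omega
        · rintro rfl; exact ⟨hcmem, by omega⟩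
      rw [hfilter, sum_singleton, if_pos ⟨c, hc⟩, netExp_centre b hb hcN]
    · rw [if_neg hev]
      refine sum_eq_zero fun s hs => ?_
      exfalso; exact hev ⟨s, by have := (mem_filter.1 hs).2; omega⟩
  -- assemble
  set A := ∑ s ∈ C.filter (fun s => 2 * s < N), netExp b s with hA
  have hE : classExp b p x = 2 * A + (if 2 ∣ N then -5 else 0) + (if ¬ (2 : ℤ) ∣ b 0 ∧ CentreIn b p x then 1 else 0) := by
    unfold classExp
    rw [← hC, hsplit, hrefl, hcentre]
    ring
  rw [hE]
  by_cases hev : 2 ∣ N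
  · have hev' : (2 : ℤ) ∣ b 0 := by rw [hb0]; exact_mod_cast hev
    rw [if_pos hev, if_neg (fun h => h.1 hev')]
    exact ⟨A - 3, by ring⟩
  · have hev' : ¬ (2 : ℤ) ∣ b 0 := by rw [hb0]; exact_mod_cast hev
    rw [if_neg hev, if_pos ⟨hev', hcen⟩]
    exact ⟨A, by ring⟩

end Summit.KontsevichZagierPeriods.Zeta5Search.SecondOrder

end
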